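import Literature.NumberTheory.Automorphic.GLnStandardLeviTwoBlockModel          -- ★ B4′ (p838606): labels, `M_{c₀}` membership, `endoGL` docking
import Literature.NumberTheory.Rogawski1990.FinExplicitTransferFactorBoxReindex   -- ★ D-S2r (p838162): `det_one_sub_boxAd_leviEmbeddingP_of_forall_eq`
import Literature.NumberTheory.Rogawski1990.LocalTransfer                          -- ★ `IsRegularElt` (separable characteristic polynomial)
import HarnessLib

/-!
# The `(k, 1)`-Levi point `p = diag(g, u)` of `GL_{k+1}`: its centraliser lies in the standard Levi subgroup
# when `det(g − u·1)` is a unit, its block data for the box of `Ad(p)`, and `det(1 − K_p) ≠ 0`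

Topic `NumberTheory/Automorphic`; namespaces `Literature.NumberTheory.Automorphic` (§1–§4) and
`Literature.NumberTheory.Rogawski1990` (§5, docking with the endoscopic pattern). KERNEL mathematics
only: theorems, no definition, no named fact, no instance, no notation, no `sorry`. Road «D-N6s» of
cell `pub/hodgecm-mathlib` (LEAD F0P3a-plan (g8) WORD T7-20 (A); cut-holder F0P3a-p03 (g9), spec
2026-09-01T00:19:25Z, brick B4″ «the (2,1)-Levi point: centraliser and box»).  For the split-place
assembly B5 of the transfer `f^H` (Rogawski 1990, Lemma 4.13.1 (a): descent of the orbital integral at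
a `(G, M)`-regular point of the Levi `M` of type `(2, 1)`), the three ALGEBRAIC binders of the descent
★ `GLnLeviOrbitalDescent.exists_lintegral_descConj_eq_mul_lintegral_levi` at the point
`p = reindexGL finSumFinEquiv (diag(g, u))` (`g ∈ GL_k(K)`, `u ∈ GL_1(K)`, labelling
`c₀ i = [k ≤ i]` of ★ `GLnStandardLeviTwoBlockModel`) are discharged from ONE scalar condition,
«`det(g − u₀₀·1)` is a unit» (over a field: `≠ 0`), itself a consequence of regular semisimplicity:

* §1 (private plumbing: a `1 × 1` matrix acts as the homothety `u₀₀`)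
  **`centralizer_le_standardLeviGL_of_isUnit_det_sub`** (any commutative ring) and
  **`centralizer_le_standardLeviGL_of_det_sub_ne_zero`** (field): `C_{GL_{k+1}}(p) ≤ M_{c₀}` — an `x`
  commuting with `p` has block form `(A B; C D)` with `g B = u₀₀ B`, `C g = u₀₀ C`, so `B = 0 = C`
  once `g − u₀₀·1` is invertible (the Sylvester equations at a point with disjoint spectra).
* §2 **`exists_eq_leviEmbeddingP_blocks`** — `p` IS `leviEmbeddingP K c₀ m` for a block family `m`
  whose first block is `g` up to the relabelling `eI : {c₀ = ff} ≃ Fin k`, `i ↦ i`, and whose second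
  block is the `1 × 1` matrix `(u₀₀)` at the unique index `j₀` of `{c₀ = tt}` — the binders
  `(m, eI, j₀, hj₀, hg, ht)` of ★ D-S2r `det_one_sub_boxAd_leviEmbeddingP_of_forall_eq` ∕
  `finWeylRatio_eq_boxAd_of_split` (existence form; no definition).
* §3 (private plumbing: `(u⁻¹)_{j₀j₀} = (u_{j₀j₀})⁻¹` on a one-element index type)
  **`det_one_sub_boxAd_ne_zero_of_det_sub_ne_zero`** — for any `p ∈ P_{c₀}` with that underlying
  element, `det(1 − K_p) ≠ 0` for the D-S1 box `K_p = Matrix.of (p q.1 q′.1 · p⁻¹ q′.2 q.2)` on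
  `{c₀ = ff} × {c₀ = tt}` (★ D-S2r: `det(1 − K_p) = det(1 − u₀₀⁻¹ • g) = u₀₀^{−k} (−1)^k det(g − u₀₀·1)`).
* §4 **`isUnit_det_sub_of_isRegularElt_reindexGL_blockDiagGL`** ∕ `det_sub_ne_zero_of_isRegularElt_…` —
  if `reindexGL e (diag(g, u))` is regular semisimple (★ `Rogawski1990.IsRegularElt`: separable
  characteristic polynomial) then `det(g − u₀₀·1)` is a unit: `χ_{diag(g,u)} = χ_g · (X − u₀₀)` is
  separable, so `χ_g` and `X − u₀₀` are coprime (Mathlib `Polynomial.Separable.isCoprime`), and a Bézout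
  relation evaluated at `u₀₀` exhibits an inverse of `χ_g(u₀₀) = det(u₀₀·1 − g)`.
* §5 `Rogawski1990.isUnit_det_sub_of_isRegularElt_endoGL` ∕ `det_sub_ne_zero_of_isRegularElt_endoGL` —
  the same read on the endoscopic pattern `endoGL (g, u) = (* 0 *; 0 * 0; * 0 *)` (`k = 2`), the
  shape delivered by ★ `LocalTransferSplitPlaceClasses.isRegularElt_endoGL_of_isLocalGRegular_of_split`.

## References

* [Rogawski1990] J. D. Rogawski, *Automorphic Representations of Unitary Groups in Three Variables*,
  Ann. of Math. Stud. 123 (1990), §4.13 «The case of split primes», Lemma 4.13.1 (a) p. 64 and its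
  proof pp. 64–66 (`P` of type `(2, 1)`, `γ` with `G_γ ⊂ M`, the factor `|(1 − γ₂γ₁⁻¹)(1 − γ₂γ₃⁻¹)|`);
  §3.1 p. 19 (regular semisimple elements).
* [BernsteinZelevinsky1977] I. N. Bernstein, A. V. Zelevinsky, *Induced representations of reductive
  `p`-adic groups I*, Ann. Sci. ÉNS 10 (1977), §2.1 (`M_β`, `P_β = M_β ⋉ U_β`).
* [PlatonovRapinchuk1994] V. Platonov, A. Rapinchuk, *Algebraic Groups and Number Theory* (1994), §2.3
  (block subgroups of `GL_n`; centralisers of semisimple elements).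
-/

set_option autoImplicit false

noncomputable section

open scoped MatrixGroups
open Matrix

namespace Literature.NumberTheory.Automorphic

/-! ### 1. The centraliser of `diag(g, u)` lies in the standard Levi subgroup -/

section Centralizer

variable {K : Type*} [CommRing K] (k : ℕ)

variable {k} in
/-- Right multiplication by a `1 × 1` matrix `u` is the homothety `u₀₀`: `B u = u₀₀ • B`. [folklore] -/
private theorem mul_fin_one_eq_smul {m : Type*} (B : Matrix m (Fin 1) K) (u : Matrix (Fin 1) (Fin 1) K) :
    B * u = u 0 0 • B := by
  ext i j
  rw [Matrix.mul_apply, Fin.sum_univ_one, Fin.fin_one_eq_zero j, Matrix.smul_apply, smul_eq_mul, mul_comm]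

variable {k} in
/-- Left multiplication by a `1 × 1` matrix `u` is the homothety `u₀₀`: `u C = u₀₀ • C`. [folklore] -/
private theorem fin_one_mul_eq_smul {m : Type*} (u : Matrix (Fin 1) (Fin 1) K) (C : Matrix (Fin 1) m K) :
    u * C = u 0 0 • C := by
  ext i j
  rw [Matrix.mul_apply, Fin.sum_univ_one, Fin.fin_one_eq_zero i, Matrix.smul_apply, smul_eq_mul]

/-- **`C_{GL_{k+1}}(diag(g, u)) ≤ M_{c₀}` when `det(g − u₀₀·1)` is a unit** (any commutative ring `K`):
an invertible `x` commuting with `p = reindexGL finSumFinEquiv (diag(g, u))` has, in the coordinates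
`Fin k ⊕ Fin 1`, block form `(A B; C D)` with `B u = g B` and `C g = u C`, i.e. `(g − u₀₀·1) B = 0` and
`C (g − u₀₀·1) = 0`; so `B = 0`, `C = 0`, and `x` is block diagonal for the labelling `c₀ i = [k ≤ i]`
(★ `mem_standardLeviGL_iff`).  (Rogawski 1990, §4.13: for a `(G, M)`-regular `γ ∈ M`, `G_γ ⊂ M`.)
[cite: Rogawski1990, §4.13, Lemma 4.13.1 (a) p. 64 and proof pp. 64–66] [cite: PlatonovRapinchuk1994, §2.3] -/
theorem centralizer_le_standardLeviGL_of_isUnit_det_sub (g : GL (Fin k) K) (u : GL (Fin 1) K)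
    (hdet : IsUnit ((g : Matrix (Fin k) (Fin k) K) -
      ((u : Matrix (Fin 1) (Fin 1) K) 0 0) • (1 : Matrix (Fin k) (Fin k) K)).det) :
    Subgroup.centralizer {UnitaryGroup.reindexGL finSumFinEquiv (UnitaryGroup.blockDiagGL (g, u))} ≤
      standardLeviGL K (fun i : Fin (k + 1) => decide (k ≤ (i : ℕ))) := by
  intro x hx
  rw [Subgroup.mem_centralizer_singleton_iff] at hx
  -- the commutation relation in the coordinates `Fin k ⊕ Fin 1`
  have hP : ((UnitaryGroup.reindexGL finSumFinEquiv (UnitaryGroup.blockDiagGL (g, u)) : GL (Fin (k + 1)) K) :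
        Matrix (Fin (k + 1)) (Fin (k + 1)) K).submatrix finSumFinEquiv finSumFinEquiv =
      Matrix.fromBlocks (g : Matrix (Fin k) (Fin k) K) 0 0 (u : Matrix (Fin 1) (Fin 1) K) := by
    rw [UnitaryGroup.coe_reindexGL, UnitaryGroup.coe_blockDiagGL, Matrix.reindex_apply,
      Matrix.submatrix_submatrix, Equiv.symm_comp_self, Matrix.submatrix_id_id]
  have hX := congrArg (fun y : GL (Fin (k + 1)) K =>
    ((y : GL (Fin (k + 1)) K) : Matrix (Fin (k + 1)) (Fin (k + 1)) K).submatrix finSumFinEquiv finSumFinEquiv) hx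
  simp only [Units.val_mul] at hX
  rw [← Matrix.submatrix_mul_equiv _ _ _ finSumFinEquiv _, ← Matrix.submatrix_mul_equiv _ _ _ finSumFinEquiv _,
    hP] at hX
  rw [← Matrix.fromBlocks_toBlocks (((x : GL (Fin (k + 1)) K) : Matrix (Fin (k + 1)) (Fin (k + 1)) K).submatrix
    finSumFinEquiv finSumFinEquiv), Matrix.fromBlocks_multiply, Matrix.fromBlocks_multiply] at hX
  simp only [Matrix.mul_zero, Matrix.zero_mul, add_zero, zero_add] at hX
  obtain ⟨-, hB, hC, -⟩ := Matrix.fromBlocks_inj.mp hX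
  -- `B = 0`
  have hB0 : (((x : GL (Fin (k + 1)) K) : Matrix (Fin (k + 1)) (Fin (k + 1)) K).submatrix
      finSumFinEquiv finSumFinEquiv).toBlocks₁₂ = 0 := by
    rw [mul_fin_one_eq_smul] at hB
    -- hB : u₀₀ • B = g * B
    have h0 : ((g : Matrix (Fin k) (Fin k) K) - ((u : Matrix (Fin 1) (Fin 1) K) 0 0) • (1 : Matrix (Fin k) (Fin k) K)) *
        (((x : GL (Fin (k + 1)) K) : Matrix (Fin (k + 1)) (Fin (k + 1)) K).submatrix
          finSumFinEquiv finSumFinEquiv).toBlocks₁₂ = 0 := by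
      rw [Matrix.sub_mul, Matrix.smul_mul, Matrix.one_mul, ← hB, sub_self]
    have h1 := congrArg (fun B => ((g : Matrix (Fin k) (Fin k) K) -
      ((u : Matrix (Fin 1) (Fin 1) K) 0 0) • (1 : Matrix (Fin k) (Fin k) K))⁻¹ * B) h0
    simp only [← Matrix.mul_assoc, Matrix.nonsing_inv_mul _ hdet, Matrix.one_mul, Matrix.mul_zero] at h1
    exact h1
  -- `C = 0`
  have hC0 : (((x : GL (Fin (k + 1)) K) : Matrix (Fin (k + 1)) (Fin (k + 1)) K).submatrix
      finSumFinEquiv finSumFinEquiv).toBlocks₂₁ = 0 := by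
    rw [fin_one_mul_eq_smul] at hC
    -- hC : C * g = u₀₀ • C
    have h0 : (((x : GL (Fin (k + 1)) K) : Matrix (Fin (k + 1)) (Fin (k + 1)) K).submatrix
          finSumFinEquiv finSumFinEquiv).toBlocks₂₁ *
        ((g : Matrix (Fin k) (Fin k) K) - ((u : Matrix (Fin 1) (Fin 1) K) 0 0) • (1 : Matrix (Fin k) (Fin k) K)) = 0 := by
      rw [Matrix.mul_sub, Matrix.mul_smul, Matrix.mul_one, hC, sub_self]
    have h1 := congrArg (fun C => C * ((g : Matrix (Fin k) (Fin k) K) -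
      ((u : Matrix (Fin 1) (Fin 1) K) 0 0) • (1 : Matrix (Fin k) (Fin k) K))⁻¹) h0
    simp only [Matrix.mul_assoc, Matrix.mul_nonsing_inv _ hdet, Matrix.mul_one, Matrix.zero_mul] at h1
    exact h1
  -- membership in `M_{c₀}`
  rw [mem_standardLeviGL_iff]
  intro i j hij
  obtain ⟨s, rfl⟩ := finSumFinEquiv.surjective i
  obtain ⟨t, rfl⟩ := finSumFinEquiv.surjective j
  rcases s with a | b <;> rcases t with a' | b'
  · exfalso; apply hij
    rw [twoBlockLabel_finSumFinEquiv_inl, twoBlockLabel_finSumFinEquiv_inl]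
  · have h := congrArg (fun B : Matrix (Fin k) (Fin 1) K => B a b') hB0
    simpa only [Matrix.toBlocks₁₂, Matrix.of_apply, Matrix.submatrix_apply, Matrix.zero_apply] using h
  · have h := congrArg (fun C : Matrix (Fin 1) (Fin k) K => C b a') hC0
    simpa only [Matrix.toBlocks₂₁, Matrix.of_apply, Matrix.submatrix_apply, Matrix.zero_apply] using h
  · exfalso; apply hij
    rw [twoBlockLabel_finSumFinEquiv_inr, twoBlockLabel_finSumFinEquiv_inr]

/-- **`C_{GL_{k+1}}(diag(g, u)) ≤ M_{c₀}` when `det(g − u₀₀·1) ≠ 0`** (field `K`; the cut-holder's token).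
[cite: Rogawski1990, §4.13, Lemma 4.13.1 (a) p. 64 and proof pp. 64–66] [cite: PlatonovRapinchuk1994, §2.3] -/
theorem centralizer_le_standardLeviGL_of_det_sub_ne_zero {K : Type*} [Field K] (g : GL (Fin k) K) (u : GL (Fin 1) K)
    (hdet : ((g : Matrix (Fin k) (Fin k) K) -
      ((u : Matrix (Fin 1) (Fin 1) K) 0 0) • (1 : Matrix (Fin k) (Fin k) K)).det ≠ 0) :
    Subgroup.centralizer {UnitaryGroup.reindexGL finSumFinEquiv (UnitaryGroup.blockDiagGL (g, u))} ≤
      standardLeviGL K (fun i : Fin (k + 1) => decide (k ≤ (i : ℕ))) :=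
  centralizer_le_standardLeviGL_of_isUnit_det_sub k g u (isUnit_iff_ne_zero.mpr hdet)

end Centralizer

/-! ### 2. `diag(g, u)` as `leviEmbeddingP c₀ m`: the block data for the box of `Ad(p)` -/

section Blocks

variable {K : Type*} [CommRing K] (k : ℕ)

/-- **The block family of `diag(g, u)`**: `reindexGL finSumFinEquiv (diag(g, u))` is
`leviEmbeddingP K c₀ m` for a family `m` over the blocks of `c₀ i = [k ≤ i]` whose `ff`-block is `g`
under the relabelling `eI : {c₀ = ff} ≃ Fin k`, `eI i = i` on values, and whose `tt`-block is the
`1 × 1` matrix `(u₀₀)` at the unique index `j₀` of `{c₀ = tt}` — exactly the binders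
`(m, eI, j₀, ∀ j, j = j₀, hg, ht)` consumed by ★ `det_one_sub_boxAd_leviEmbeddingP_of_forall_eq` and
★ `finWeylRatio_eq_boxAd_of_split` (existence form, no definition introduced).
[cite: BernsteinZelevinsky1977, §2.1] [cite: Rogawski1990, §4.13, proof of Lemma 4.13.1, pp. 64–66] -/
theorem exists_eq_leviEmbeddingP_blocks (g : GL (Fin k) K) (u : GL (Fin 1) K) :
    ∃ (m : Π b : Bool, GL {i : Fin (k + 1) // decide (k ≤ (i : ℕ)) = b} K)
      (eI : {i : Fin (k + 1) // decide (k ≤ (i : ℕ)) = false} ≃ Fin k)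
      (j₀ : {j : Fin (k + 1) // decide (k ≤ (j : ℕ)) = true}),
      (∀ j, j = j₀) ∧ (∀ i, ((eI i : Fin k) : ℕ) = ((i : Fin (k + 1)) : ℕ)) ∧
      (leviEmbeddingP K (fun i : Fin (k + 1) => decide (k ≤ (i : ℕ))) m : GL (Fin (k + 1)) K) =
        UnitaryGroup.reindexGL finSumFinEquiv (UnitaryGroup.blockDiagGL (g, u)) ∧
      Matrix.reindex eI eI ((m false : GL {i : Fin (k + 1) // decide (k ≤ (i : ℕ)) = false} K) :
          Matrix {i : Fin (k + 1) // decide (k ≤ (i : ℕ)) = false} {i : Fin (k + 1) // decide (k ≤ (i : ℕ)) = false} K) =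
        (g : Matrix (Fin k) (Fin k) K) ∧
      ((m true : GL {j : Fin (k + 1) // decide (k ≤ (j : ℕ)) = true} K) :
          Matrix {j : Fin (k + 1) // decide (k ≤ (j : ℕ)) = true} {j : Fin (k + 1) // decide (k ≤ (j : ℕ)) = true} K) j₀ j₀ =
        (u : Matrix (Fin 1) (Fin 1) K) 0 0 := by
  obtain ⟨m, hm⟩ := reindexGL_finSumFinEquiv_blockDiagGL_mem_standardLeviGL (x := (g, u))
  -- the relabelling of the first block and the unique index of the second
  have hval : ∀ a : Fin k, ((finSumFinEquiv (Sum.inl a) : Fin (k + 1)) : ℕ) = (a : ℕ) := fun a => by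
    rw [finSumFinEquiv_apply_left, Fin.val_castAdd]
  have hlt : ∀ i : {i : Fin (k + 1) // decide (k ≤ (i : ℕ)) = false}, ((i : Fin (k + 1)) : ℕ) < k := fun i =>
    not_le.mp (of_decide_eq_false i.2)
  let eI : {i : Fin (k + 1) // decide (k ≤ (i : ℕ)) = false} ≃ Fin k :=
    { toFun := fun i => ⟨((i : Fin (k + 1)) : ℕ), hlt i⟩
      invFun := fun a => ⟨finSumFinEquiv (Sum.inl a), twoBlockLabel_finSumFinEquiv_inl k 1 a⟩
      left_inv := fun i => Subtype.ext (Fin.ext (hval _))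
      right_inv := fun a => Fin.ext (hval a) }
  let j₀ : {j : Fin (k + 1) // decide (k ≤ (j : ℕ)) = true} :=
    ⟨finSumFinEquiv (Sum.inr 0), twoBlockLabel_finSumFinEquiv_inr k 1 0⟩
  have hj₀ : ∀ j : {j : Fin (k + 1) // decide (k ≤ (j : ℕ)) = true}, j = j₀ := fun j => by
    refine Subtype.ext (Fin.ext ?_)
    have h1 : k ≤ ((j : Fin (k + 1)) : ℕ) := of_decide_eq_true j.2
    have h2 : ((j : Fin (k + 1)) : ℕ) < k + 1 := (j : Fin (k + 1)).isLt
    have h3 : ((j₀ : Fin (k + 1)) : ℕ) = k := by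
      show ((finSumFinEquiv (Sum.inr (0 : Fin 1)) : Fin (k + 1)) : ℕ) = k
      rw [finSumFinEquiv_apply_right, Fin.val_natAdd, Fin.val_zero, add_zero]
    rw [h3]; omega
  -- entries of `p = diag(g, u)` in the coordinates `Fin k ⊕ Fin 1`
  have hp : ∀ s t : Fin k ⊕ Fin 1,
      ((UnitaryGroup.reindexGL finSumFinEquiv (UnitaryGroup.blockDiagGL (g, u)) : GL (Fin (k + 1)) K) :
          Matrix (Fin (k + 1)) (Fin (k + 1)) K) (finSumFinEquiv s) (finSumFinEquiv t) =
        Matrix.fromBlocks (g : Matrix (Fin k) (Fin k) K) 0 0 (u : Matrix (Fin 1) (Fin 1) K) s t := fun s t => by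
    rw [UnitaryGroup.coe_reindexGL, Matrix.reindex_apply, Matrix.submatrix_apply, Equiv.symm_apply_apply,
      Equiv.symm_apply_apply, UnitaryGroup.coe_blockDiagGL]
  have hmb : ∀ (b : Bool) (i j : {i : Fin (k + 1) // decide (k ≤ (i : ℕ)) = b}),
      ((m b : GL _ K) : Matrix _ _ K) i j =
        ((UnitaryGroup.reindexGL finSumFinEquiv (UnitaryGroup.blockDiagGL (g, u)) : GL (Fin (k + 1)) K) :
          Matrix (Fin (k + 1)) (Fin (k + 1)) K) i j := fun b i j => by
    rw [← hm, leviEmbedding_apply, blockDiagonalGL_apply_coe_of_block]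
  refine ⟨m, eI, j₀, hj₀, fun i => rfl, hm, ?_, ?_⟩
  · ext a a'
    rw [Matrix.reindex_apply, Matrix.submatrix_apply, hmb]
    exact (hp (Sum.inl a) (Sum.inl a')).trans (Matrix.fromBlocks_apply₁₁ _ _ _ _ a a')
  · rw [hmb]
    exact (hp (Sum.inr 0) (Sum.inr 0)).trans (Matrix.fromBlocks_apply₂₂ _ _ _ _ 0 0)

end Blocks

/-! ### 3. `det(1 − K_p) ≠ 0` for the box of `Ad(diag(g, u))` -/

section Box

variable {K : Type*} [Field K] (k : ℕ)

/-- On an index type with a single element `j₀`, the `(j₀, j₀)` entry of `u⁻¹ ∈ GL_J(K)` is the inverse of that of `u`. [folklore] -/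
private theorem GeneralLinearGroup.inv_apply_eq_inv_of_forall_eq {J : Type*} [Fintype J] [DecidableEq J] (u : GL J K) (j₀ : J)
    (hj₀ : ∀ j : J, j = j₀) :
    (((u⁻¹ : GL J K) : Matrix J J K) j₀ j₀) = (((u : GL J K) : Matrix J J K) j₀ j₀)⁻¹ := by
  haveI : Subsingleton J := ⟨fun a b => (hj₀ a).trans (hj₀ b).symm⟩
  have h := congrArg (fun w : GL J K => ((w : GL J K) : Matrix J J K) j₀ j₀) (inv_mul_cancel u)
  simp only [Units.val_mul, Matrix.mul_apply, Fintype.sum_subsingleton _ j₀, Units.val_one, Matrix.one_apply_eq] at h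
  exact eq_inv_of_mul_eq_one_left h

/-- **`det(1 − K_p) ≠ 0` at `p = diag(g, u)` from `det(g − u₀₀·1) ≠ 0`**: for any element `p` of the
standard parabolic `P_{c₀}` whose underlying invertible matrix is `reindexGL finSumFinEquiv (diag(g, u))`,
the D-S1 box `K_p = Matrix.of (p q.1 q′.1 · p⁻¹ q′.2 q.2)` on `{c₀ = ff} × {c₀ = tt}` satisfies
`det(1 − K_p) = det(1 − u₀₀⁻¹ • g) = u₀₀^{−k} (−1)^k det(g − u₀₀·1) ≠ 0` (★ D-S2r
`det_one_sub_boxAd_leviEmbeddingP_of_forall_eq` through §2) — the binder `_hp` of ★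
`exists_lintegral_descConj_eq_mul_lintegral_levi` (print: `D_{G∕M}(γ) ≠ 0` at a `(G, M)`-regular `γ`).
[cite: Rogawski1990, §4.13, Lemma 4.13.1 (a) p. 64 and proof pp. 64–66] -/
theorem det_one_sub_boxAd_ne_zero_of_det_sub_ne_zero (g : GL (Fin k) K) (u : GL (Fin 1) K)
    (hdet : ((g : Matrix (Fin k) (Fin k) K) -
      ((u : Matrix (Fin 1) (Fin 1) K) 0 0) • (1 : Matrix (Fin k) (Fin k) K)).det ≠ 0)
    (p : standardParabolicGL K (fun i : Fin (k + 1) => decide (k ≤ (i : ℕ))))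
    (hp : (p : GL (Fin (k + 1)) K) = UnitaryGroup.reindexGL finSumFinEquiv (UnitaryGroup.blockDiagGL (g, u))) :
    (1 - Matrix.of fun q q' : {i : Fin (k + 1) // decide (k ≤ (i : ℕ)) = false} ×
        {j : Fin (k + 1) // decide (k ≤ (j : ℕ)) = true} =>
      ((p : GL (Fin (k + 1)) K) : Matrix (Fin (k + 1)) (Fin (k + 1)) K) q.1 q'.1 *
        (((p⁻¹ : standardParabolicGL K (fun i : Fin (k + 1) => decide (k ≤ (i : ℕ)))) : GL (Fin (k + 1)) K) :
          Matrix (Fin (k + 1)) (Fin (k + 1)) K) q'.2 q.2).det ≠ 0 := by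
  obtain ⟨m, eI, j₀, hj₀, -, hm, hg, ht⟩ := exists_eq_leviEmbeddingP_blocks k g u
  obtain rfl : p = leviEmbeddingP K (fun i : Fin (k + 1) => decide (k ≤ (i : ℕ))) m := Subtype.ext (hp.trans hm.symm)
  rw [det_one_sub_boxAd_leviEmbeddingP_of_forall_eq m j₀ hj₀ eI, hg,
    GeneralLinearGroup.inv_apply_eq_inv_of_forall_eq (m true) j₀ hj₀, ht]
  -- `det(1 − u₀₀⁻¹ • g) = u₀₀^{−k} · (−1)^k · det(g − u₀₀·1)`
  have hu : ((u : Matrix (Fin 1) (Fin 1) K) 0 0) ≠ 0 := by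
    have h := (Matrix.isUnit_iff_isUnit_det (u : Matrix (Fin 1) (Fin 1) K)).mp u.isUnit
    rw [Matrix.det_fin_one] at h
    exact h.ne_zero
  have h1 : (1 : Matrix (Fin k) (Fin k) K) - ((u : Matrix (Fin 1) (Fin 1) K) 0 0)⁻¹ • (g : Matrix (Fin k) (Fin k) K) =
      ((u : Matrix (Fin 1) (Fin 1) K) 0 0)⁻¹ •
        -((g : Matrix (Fin k) (Fin k) K) - ((u : Matrix (Fin 1) (Fin 1) K) 0 0) • (1 : Matrix (Fin k) (Fin k) K)) := by
    rw [neg_sub, smul_sub, smul_smul, inv_mul_cancel₀ hu, one_smul]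
  rw [h1, Matrix.det_smul, Matrix.det_neg]
  exact mul_ne_zero (pow_ne_zero _ (inv_ne_zero hu)) (mul_ne_zero (pow_ne_zero _ (neg_ne_zero.mpr one_ne_zero)) hdet)

end Box

/-! ### 4. `det(g − u₀₀·1)` is a unit when `diag(g, u)` is regular semisimple -/

section Regular

variable {K : Type*} [CommRing K] (k : ℕ)

/-- **Regular semisimplicity of `diag(g, u)` makes `det(g − u₀₀·1)` a unit** (any commutative ring, any
reindexing `e : Fin k ⊕ Fin 1 ≃ n`): the characteristic polynomial of `reindex e e (diag(g, u))` is
`χ_g · χ_u` (Mathlib `charpoly_reindex`, `charpoly_fromBlocks_zero₁₂`); if it is separable, `χ_g` and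
`χ_u` are coprime (`Polynomial.Separable.isCoprime`), and evaluating a Bézout relation
`a χ_g + b χ_u = 1` at `u₀₀`, a root of `χ_u`, inverts `χ_g(u₀₀) = det(u₀₀·1 − g) = (−1)^k det(g − u₀₀·1)`.
[cite: Rogawski1990, §3.1 p. 19; §4.13 p. 64] -/
theorem isUnit_det_sub_of_isRegularElt_reindexGL_blockDiagGL {n : Type*} [Fintype n] [DecidableEq n]
    (e : Fin k ⊕ Fin 1 ≃ n) (g : GL (Fin k) K) (u : GL (Fin 1) K)
    (h : Rogawski1990.IsRegularElt (UnitaryGroup.reindexGL e (UnitaryGroup.blockDiagGL (g, u)))) :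
    IsUnit ((g : Matrix (Fin k) (Fin k) K) -
      ((u : Matrix (Fin 1) (Fin 1) K) 0 0) • (1 : Matrix (Fin k) (Fin k) K)).det := by
  rw [Rogawski1990.isRegularElt_iff, UnitaryGroup.coe_reindexGL, Matrix.charpoly_reindex, UnitaryGroup.coe_blockDiagGL,
    Matrix.charpoly_fromBlocks_zero₁₂] at h
  obtain ⟨a, b, hab⟩ := h.isCoprime
  have hev := congrArg (Polynomial.eval ((u : Matrix (Fin 1) (Fin 1) K) 0 0)) hab
  have hu0 : ((u : Matrix (Fin 1) (Fin 1) K).charpoly).eval ((u : Matrix (Fin 1) (Fin 1) K) 0 0) = 0 := by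
    rw [Matrix.eval_charpoly, Matrix.det_fin_one, Matrix.sub_apply, Matrix.scalar_apply, Matrix.diagonal_apply_eq,
      sub_self]
  rw [Polynomial.eval_add, Polynomial.eval_mul, Polynomial.eval_mul, hu0, mul_zero, add_zero, Polynomial.eval_one,
    Matrix.eval_charpoly] at hev
  -- `hev : a(u₀₀) · det(u₀₀·1 − g) = 1`
  have hsc : Matrix.scalar (Fin k) ((u : Matrix (Fin 1) (Fin 1) K) 0 0) - (g : Matrix (Fin k) (Fin k) K) =
      -((g : Matrix (Fin k) (Fin k) K) - ((u : Matrix (Fin 1) (Fin 1) K) 0 0) • (1 : Matrix (Fin k) (Fin k) K)) := by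
    rw [neg_sub, Matrix.smul_one_eq_diagonal, ← Matrix.scalar_apply]
  rw [hsc, Matrix.det_neg, ← mul_assoc] at hev
  exact IsUnit.of_mul_eq_one_right _ hev

/-- **Field form**: `det(g − u₀₀·1) ≠ 0` when `reindex e e (diag(g, u))` is regular semisimple (`K` a field,
`Nontrivial`). [cite: Rogawski1990, §3.1 p. 19; §4.13 p. 64] -/
theorem det_sub_ne_zero_of_isRegularElt_reindexGL_blockDiagGL {K : Type*} [Field K] {n : Type*} [Fintype n]
    [DecidableEq n] (e : Fin k ⊕ Fin 1 ≃ n) (g : GL (Fin k) K) (u : GL (Fin 1) K)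
    (h : Rogawski1990.IsRegularElt (UnitaryGroup.reindexGL e (UnitaryGroup.blockDiagGL (g, u)))) :
    ((g : Matrix (Fin k) (Fin k) K) - ((u : Matrix (Fin 1) (Fin 1) K) 0 0) • (1 : Matrix (Fin k) (Fin k) K)).det ≠ 0 :=
  (isUnit_det_sub_of_isRegularElt_reindexGL_blockDiagGL k e g u h).ne_zero

end Regular

end Literature.NumberTheory.Automorphic

/-! ### 5. Docking with the endoscopic pattern `endoGL (g, u)` (`k = 2`) -/

namespace Literature.NumberTheory.Rogawski1990

open Literature.NumberTheory.Automorphic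

/-- **`det(g − u₀₀·1)` is a unit when `endoGL (g, u) = (* 0 *; 0 * 0; * 0 *)` is regular semisimple**
(★ `endoGL = reindexGL endoPerm ∘ blockDiagGL`; the shape delivered at a split place by ★
`isRegularElt_endoGL_of_isLocalGRegular_of_split`). [cite: Rogawski1990, §3.1 p. 19; §4.9 p. 54; §4.13 p. 64] -/
theorem isUnit_det_sub_of_isRegularElt_endoGL {S : Type*} [CommRing S] (g : GL (Fin 2) S) (u : GL (Fin 1) S)
    (h : IsRegularElt (endoGL (g, u))) :
    IsUnit ((g : Matrix (Fin 2) (Fin 2) S) - ((u : Matrix (Fin 1) (Fin 1) S) 0 0) • (1 : Matrix (Fin 2) (Fin 2) S)).det :=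
  isUnit_det_sub_of_isRegularElt_reindexGL_blockDiagGL 2 endoPerm g u h

/-- **Field form**: `det(g − u₀₀·1) ≠ 0` when `endoGL (g, u)` is regular semisimple — with ★ §1–§3 this
discharges, at a split place, the three algebraic binders (`C_{G₃}(p) ≤ M_{c₀}`, `p = leviEmbeddingP c₀ m`
with blocks `(g, u₀₀)`, `det(1 − K_p) ≠ 0`) of the Levi descent at `p = reindexGL finSumFinEquiv (diag(g, u))`,
the standard-Levi conjugate of `endoGL (g, u)` (★ `isConj_endoGL_reindexGL_blockDiagGL`).
[cite: Rogawski1990, §3.1 p. 19; §4.9 p. 54; §4.13, Lemma 4.13.1 (a) p. 64] -/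
theorem det_sub_ne_zero_of_isRegularElt_endoGL {K : Type*} [Field K] (g : GL (Fin 2) K) (u : GL (Fin 1) K)
    (h : IsRegularElt (endoGL (g, u))) :
    ((g : Matrix (Fin 2) (Fin 2) K) - ((u : Matrix (Fin 1) (Fin 1) K) 0 0) • (1 : Matrix (Fin 2) (Fin 2) K)).det ≠ 0 :=
  (isUnit_det_sub_of_isRegularElt_endoGL g u h).ne_zero

end Literature.NumberTheory.Rogawski1990

end
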